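import Literature.AlgebraicGeometry.Resolution.QuadraticTransforms
import HarnessLib

/-!
# Crux `Steer` (stmt-ResolutionOfSingularities-16345), chain W4.1, R2 σ_top line, piece G `GeoDict` — part (g1):
# local blowing up along a centre `P` versus localising at a prime over `P` (Theses-free)

OURS (campaign `res-hironaka`, rung L ★L-G4, slot W4.1, chain W4.1, seat `res-L0-w41-stub-7` = `res-D-pv-011`, holder
of G per res-L0-w41-plan-1 ORDER 05:03:22Z / res-type-096 DECLINE 05:21:05Z; replaces the role of no printed item; NOT a
statement of the manuscript under review; AI review is weaker than expert review). Piece G `GeoDict` of the planner's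
typed sub-plan `L/w41/Sketch-R2-steered.lean` (fb4f9514a6cb98fe, §3.4) reads a DOMINANT TAIL of a σ_top-steered run as an
eternal isolated radicand chain of codimension `c` (idea-1's `NoEternalIsolatedRadicandChain p c`), whose members are the
LOCALISATIONS `S m = (R i)_{P i}` of the run's members at the centres. The chain rings are realised inside the ambient
field `K` DEF-FREE, through the membership characterisation

  `hT : ∀ z : K, z ∈ T ↔ ∃ a b : R, b ∉ P ∧ z = a / b`        («`T` is `R_P` inside `K`»),

and this file proves the purely ring-theoretic part (g1) of G over it (Cutkosky 2014 §2.1 «monoidal transform with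
centre P, followed by localisation»):

* `GeoDict.isLocalRing_of_locChar`, `mem_maximalIdeal_iff_of_locChar`, `not_isUnit_iff_of_locChar` — `R_P` is local with
  maximal ideal `{a/b : a ∈ P, b ∉ P}` (`P` prime);
* `GeoDict.le_of_locChar_of_comap` — along `R ≤ R₁` with `P₁ ∩ R = P`: `R_P ⊆ (R₁)_{P₁}`;
* `GeoDict.subringDominates_of_locChar_of_comap` — and `(R₁)_{P₁}` dominates `R_P`;
* **`GeoDict.isQuadraticTransform_of_isLocalBlowupAlong`** — if `R₁` is the LOCAL BLOWING UP of `R` ALONG `P` with respect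
  to a valuation ring `O` (Novacoski–Spivakovsky Def. 2.11, tree `IsLocalBlowupAlong`) and `P₁ ∩ R = P`, then
  `R_P → (R₁)_{P₁}` is a QUADRATIC TRANSFORM (tree `IsQuadraticTransform`, Cutkosky §2.1) along the exceptional
  generator `u₀` (`P·R₁ = u₀·R₁`, `IsLocalBlowupAlong.exists_span_singleton`): `R_P[𝔪/u₀] ⊆ (R₁)_{P₁}`, every element of
  `(R₁)_{P₁}` is a fraction of elements of `R[P/u₀] ⊆ R_P[𝔪/u₀]` with denominator a unit of `(R₁)_{P₁}`;
* `GeoDict.span_image_maximalIdeal_eq_of_locChar` — `𝔪_{R_P}·(R₁)_{P₁} = (x)` for any `x ∈ P` dividing `P` in `R₁`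
  (the exceptional parameter of the strict-transform step).
[cite: Cutkosky2014, §2.1] [cite: NovacoskiSpivakovsky2014, Def. 2.11] [folklore]
-/

noncomputable section

-- `Summit.<S>.<S>.…` duplicates the summit name by design (single-problem summit).
set_option linter.dupNamespace false

open IsLocalRing

namespace Summit.ResolutionOfSingularities.ResolutionOfSingularities.Theorems.SwitchingDichotomy

open Literature.AlgebraicGeometry.Resolution

namespace GeoDict

universe u

variable {K : Type u} [Field K]

/-! ## `R_P` inside `K`, through its membership characterisation -/

section LocChar

variable {R : Subring K} {P : Ideal R} [hP : P.IsPrime] {T : Subring K}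
  (hT : ∀ z : K, z ∈ T ↔ ∃ a b : R, b ∉ P ∧ z = (a : K) / b)
include hT

omit hP in
/-- `a / b ∈ R_P` for `a ∈ R`, `b ∈ R ∖ P`. [folklore] -/
theorem div_mem_of_locChar (a b : R) (hb : b ∉ P) : (a : K) / b ∈ T := (hT _).mpr ⟨a, b, hb, rfl⟩

/-- `R ⊆ R_P`. [folklore] -/
theorem le_of_locChar : R ≤ T := fun z hz =>
  (hT z).mpr ⟨⟨z, hz⟩, 1, fun h => hP.ne_top (P.eq_top_of_isUnit_mem h isUnit_one), by simp⟩

omit hP hT in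
/-- A denominator is non-zero in `K`. [folklore] -/
theorem coe_ne_zero_of_not_mem {b : R} (hb : b ∉ P) : (b : K) ≠ 0 := by
  intro h
  apply hb
  have : b = 0 := Subtype.ext h
  rw [this]
  exact P.zero_mem

/-- **Non-units of `R_P`**: `z ∈ R_P` is a non-unit iff `z = a / b` with `a ∈ P`, `b ∉ P`. [folklore] -/
theorem not_isUnit_iff_of_locChar (z : T) : ¬ IsUnit z ↔ ∃ a b : R, a ∈ P ∧ b ∉ P ∧ (z : K) = a / b := by
  -- for ANY representation `z = a / b`, `z` is a unit iff `a ∉ P`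
  have key : ∀ a b : R, b ∉ P → (z : K) = a / b → (IsUnit z ↔ a ∉ P) := by
    intro a b hb hz
    have hb0 := coe_ne_zero_of_not_mem hb
    constructor
    · intro hu haP
      obtain ⟨h0, hinv⟩ := (isUnit_subring_iff_inv_mem z).mp hu
      obtain ⟨a', b', hb', he⟩ := (hT _).mp hinv
      have hb'0 := coe_ne_zero_of_not_mem hb'
      have ha0 : (a : K) ≠ 0 := by
        intro ha
        apply h0
        rw [hz, ha, zero_div]
      -- `b b' = a a'` in `R`
      have heq : b * b' = a * a' := by
        apply Subtype.ext
        show (b : K) * b' = a * a'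
        rw [hz, inv_div] at he
        field_simp at he
        linear_combination he
      have hmem : b * b' ∈ P := by rw [heq]; exact P.mul_mem_right _ haP
      rcases hP.mem_or_mem hmem with h | h
      · exact hb h
      · exact hb' h
    · intro haP
      refine (isUnit_subring_iff_inv_mem z).mpr ⟨?_, ?_⟩
      · rw [hz]
        exact div_ne_zero (coe_ne_zero_of_not_mem haP) hb0
      · rw [hz, inv_div]
        exact div_mem_of_locChar hT b a haP
  constructor
  · intro hnu
    obtain ⟨a, b, hb, hz⟩ := (hT _).mp z.2
    refine ⟨a, b, ?_, hb, hz⟩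
    by_contra haP
    exact hnu ((key a b hb hz).mpr haP)
  · rintro ⟨a, b, ha, hb, hz⟩ hu
    exact (key a b hb hz).mp hu ha

/-- **`R_P` is a local ring** (`P` prime): sums of non-units `a₁/b₁ + a₂/b₂ = (a₁b₂ + a₂b₁)/(b₁b₂)` are non-units.
[folklore] -/
theorem isLocalRing_of_locChar : IsLocalRing T := by
  haveI : Nontrivial T := ⟨⟨0, 1, zero_ne_one⟩⟩
  refine IsLocalRing.of_nonunits_add ?_
  intro z w hz hw
  rw [mem_nonunits_iff, not_isUnit_iff_of_locChar hT] at hz hw ⊢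
  obtain ⟨a₁, b₁, ha₁, hb₁, hz⟩ := hz
  obtain ⟨a₂, b₂, ha₂, hb₂, hw⟩ := hw
  refine ⟨a₁ * b₂ + a₂ * b₁, b₁ * b₂, P.add_mem (P.mul_mem_right _ ha₁) (P.mul_mem_right _ ha₂),
    fun h => (hP.mem_or_mem h).elim hb₁ hb₂, ?_⟩
  have h1 := coe_ne_zero_of_not_mem hb₁
  have h2 := coe_ne_zero_of_not_mem hb₂
  show (z : K) + w = _
  rw [hz, hw, Subring.coe_mul, Subring.coe_add, Subring.coe_mul, Subring.coe_mul]
  field_simp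

/-- **The maximal ideal of `R_P`** is `{a/b : a ∈ P, b ∉ P} = P·R_P`. [folklore] -/
theorem mem_maximalIdeal_iff_of_locChar [IsLocalRing T] (z : T) :
    z ∈ maximalIdeal T ↔ ∃ a b : R, a ∈ P ∧ b ∉ P ∧ (z : K) = a / b := by
  rw [IsLocalRing.mem_maximalIdeal, mem_nonunits_iff, not_isUnit_iff_of_locChar hT]

/-- **`R_P` inside `K` IS the localisation of `R` at `P`**: for any `R`-algebra structure on `T` compatible with the
coercions to `K`, `IsLocalization.AtPrime T P`. [folklore] -/
theorem isLocalization_of_locChar [Algebra R T] (halg : ∀ r : R, ((algebraMap R T r : T) : K) = r) :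
    IsLocalization.AtPrime T P := by
  rw [IsLocalization.AtPrime, isLocalization_iff]
  refine ⟨fun y => ?_, fun z => ?_, fun {x y} h => ⟨1, ?_⟩⟩
  · have hy : (y : R) ∉ P := y.2
    refine (isUnit_subring_iff_inv_mem _).mpr ⟨?_, ?_⟩
    · rw [halg]
      exact coe_ne_zero_of_not_mem hy
    · rw [halg, ← one_div, ← Subring.coe_one R]
      exact div_mem_of_locChar hT 1 y hy
  · obtain ⟨a, b, hb, hz⟩ := (hT z).mp z.2
    refine ⟨(a, ⟨b, hb⟩), Subtype.ext ?_⟩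
    show (z : K) * ((algebraMap R T b : T) : K) = ((algebraMap R T a : T) : K)
    rw [halg, halg, hz, div_mul_cancel₀ _ (coe_ne_zero_of_not_mem hb)]
  · have := congrArg (fun w : T => (w : K)) h
    simp only [halg] at this
    rw [Subtype.ext this]

end LocChar

/-! ## `R_P ⊆ (R₁)_{P₁}` and domination, for `R ≤ R₁` with `P₁ ∩ R = P` -/

section Comap

variable {R R₁ : Subring K} {P : Ideal R} [hP : P.IsPrime] {P₁ : Ideal R₁} [hP₁ : P₁.IsPrime]
  (hle : R ≤ R₁) (hcomap : P₁.comap (Subring.inclusion hle) = P)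
  {T T₁ : Subring K} (hT : ∀ z : K, z ∈ T ↔ ∃ a b : R, b ∉ P ∧ z = (a : K) / b)
  (hT₁ : ∀ z : K, z ∈ T₁ ↔ ∃ a b : R₁, b ∉ P₁ ∧ z = (a : K) / b)
include hcomap

omit hP hP₁ in
/-- `b ∈ P ↔ b ∈ P₁` for `b ∈ R`. [folklore] -/
theorem inclusion_mem_iff_of_comap (b : R) : (⟨(b : K), hle b.2⟩ : R₁) ∈ P₁ ↔ b ∈ P := by
  rw [← hcomap, Ideal.mem_comap]
  rfl

include hT hT₁

omit hP hP₁ in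
/-- **`R_P ⊆ (R₁)_{P₁}`** when `R ⊆ R₁` and `P₁ ∩ R = P`. [folklore] -/
theorem le_of_locChar_of_comap : T ≤ T₁ := by
  intro z hz
  obtain ⟨a, b, hb, rfl⟩ := (hT z).mp hz
  exact (hT₁ _).mpr ⟨⟨a, hle a.2⟩, ⟨b, hle b.2⟩,
    fun h => hb ((inclusion_mem_iff_of_comap hle hcomap b).mp h), rfl⟩

omit hP in
/-- **`(R₁)_{P₁}` dominates `R_P`**: an element of `R_P` invertible in `(R₁)_{P₁}` is invertible in `R_P`. [folklore] -/
theorem subringDominates_of_locChar_of_comap : SubringDominates T T₁ := by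
  refine ⟨le_of_locChar_of_comap hle hcomap hT hT₁, fun z hz hzi => ?_⟩
  obtain ⟨a, b, hb, rfl⟩ := (hT z).mp hz
  by_cases ha : a ∈ P
  · -- then `a / b` is not invertible in `(R₁)_{P₁}` unless `a = 0`
    by_cases ha0 : (a : K) = 0
    · rw [ha0, zero_div, inv_zero]
      exact T.zero_mem
    · exfalso
      obtain ⟨a₁, b₁, hb₁, he⟩ := (hT₁ _).mp hzi
      have hb0 : (b : K) ≠ 0 := coe_ne_zero_of_not_mem hb
      have hb₁0 : (b₁ : K) ≠ 0 := coe_ne_zero_of_not_mem hb₁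
      -- `b · b₁ = a · a₁` in `R₁`
      have heq : (⟨(b : K), hle b.2⟩ : R₁) * b₁ = ⟨(a : K), hle a.2⟩ * a₁ := by
        apply Subtype.ext
        show (b : K) * b₁ = a * a₁
        rw [inv_div] at he
        field_simp at he
        linear_combination he
      have hmem : (⟨(b : K), hle b.2⟩ : R₁) * b₁ ∈ P₁ := by
        rw [heq]
        exact P₁.mul_mem_right _ ((inclusion_mem_iff_of_comap hle hcomap a).mpr ha)
      rcases hP₁.mem_or_mem hmem with h | h
      · exact hb ((inclusion_mem_iff_of_comap hle hcomap b).mp h)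
      · exact hb₁ h
  · rw [inv_div]
    exact div_mem_of_locChar hT b a ha

end Comap

/-! ## The local blowing up along `P`, localised at a prime over `P`, is a quadratic transform of `R_P` -/

section Quadratic

variable {O : ValuationSubring K} {R R₁ : Subring K} {P : Ideal R} [hP : P.IsPrime] {P₁ : Ideal R₁}
  [hP₁ : P₁.IsPrime] (hbl : IsLocalBlowupAlong O R P R₁)
  (hle : R ≤ R₁) (hcomap : P₁.comap (Subring.inclusion hle) = P)
  {T T₁ : Subring K} (hT : ∀ z : K, z ∈ T ↔ ∃ a b : R, b ∉ P ∧ z = (a : K) / b)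
  (hT₁ : ∀ z : K, z ∈ T₁ ↔ ∃ a b : R₁, b ∉ P₁ ∧ z = (a : K) / b)
include hbl hcomap hT hT₁

/-- **Cutkosky §2.1 for the centre `P`, localised**: if `R₁` is the local blowing up of `R` along `P` with respect to
`O` and `P₁` is a prime of `R₁` over `P`, then `R_P → (R₁)_{P₁}` is a quadratic transform along the exceptional generator
`u₀` of `P·R₁`. [cite: Cutkosky2014, §2.1] [cite: NovacoskiSpivakovsky2014, Def. 2.11] -/
theorem isQuadraticTransform_of_isLocalBlowupAlong : IsQuadraticTransform T T₁ := by
  classical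
  haveI hTloc : IsLocalRing T := isLocalRing_of_locChar hT
  haveI hT₁loc : IsLocalRing T₁ := isLocalRing_of_locChar hT₁
  have hTT₁ : T ≤ T₁ := le_of_locChar_of_comap hle hcomap hT hT₁
  obtain ⟨hRO, u, u₀, hspan, hu₀, hu₀0, hval, hR₁⟩ := hbl
  have hu₀P : u₀ ∈ P := hspan ▸ Ideal.subset_span hu₀
  have hu₀0' : ((u₀ : R) : K) ≠ 0 := fun e => hu₀0 (Subtype.ext e)
  have hu₀T : ((u₀ : R) : K) ∈ T := le_of_locChar hT u₀.2
  -- the chart ring `C = R[u/u₀]` and `R₁ = C_{𝔪_O ∩ C}`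
  set C := Subring.closure ((R : Set K) ∪ (fun x : R => (x : K) / u₀) '' ↑u) with hC
  have hCR₁ : C ≤ R₁ := hR₁ ▸ le_locAtCentre C O
  -- every `a ∈ P` is divisible by `u₀` in `C`
  have hdivC : ∀ a ∈ P, (a : K) / u₀ ∈ C := by
    intro a ha
    rw [← hspan] at ha
    induction ha using Submodule.span_induction with
    | mem x hx => exact Subring.subset_closure (Or.inr ⟨x, hx, rfl⟩)
    | zero => simp
    | add x y _ _ hx hy => rw [Subring.coe_add, add_div]; exact C.add_mem hx hy
    | smul a x _ hx =>
      rw [smul_eq_mul, Subring.coe_mul, mul_div_assoc]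
      exact C.mul_mem (Subring.subset_closure (Or.inl a.2)) hx
  -- `u₀ ∈ 𝔪_{R_P}`
  have hu₀max : (⟨(u₀ : K), hu₀T⟩ : T) ∈ maximalIdeal T :=
    (mem_maximalIdeal_iff_of_locChar hT _).mpr ⟨u₀, 1,  hu₀P,
      fun h => hP.ne_top (P.eq_top_of_isUnit_mem h isUnit_one), by simp⟩
  -- `C ⊆ R_P[𝔪/u₀]`
  have hCbl : C ≤ blowupRing T ((u₀ : R) : K) := by
    refine Subring.closure_le.mpr ?_
    rintro z (hz | ⟨x, hx, rfl⟩)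
    · exact le_blowupRing T _ (le_of_locChar hT hz)
    · have hxP : x ∈ P := hspan ▸ Ideal.subset_span hx
      have hxT : (x : K) ∈ T := le_of_locChar hT x.2
      have hxmax : (⟨(x : K), hxT⟩ : T) ∈ maximalIdeal T :=
        (mem_maximalIdeal_iff_of_locChar hT _).mpr ⟨x, 1, hxP,
          fun h => hP.ne_top (P.eq_top_of_isUnit_mem h isUnit_one), by simp⟩
      exact div_mem_blowupRing ((u₀ : R) : K) hxmax
  -- units of `R₁` are outside `P₁`
  have hunit : ∀ d : K, d ∈ C → O.valuation d = 1 → ∃ hd : d ∈ R₁, (⟨d, hd⟩ : R₁) ∉ P₁ := by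
    intro d hdC hvd
    have hdR₁ : d ∈ R₁ := hCR₁ hdC
    have hdinv : d⁻¹ ∈ R₁ := by
      rw [hR₁]
      exact inv_mem_locAtCentre (le_locAtCentre C O hdC) hvd
    refine ⟨hdR₁, fun hmem => hP₁.ne_top (Ideal.eq_top_of_isUnit_mem _ hmem ?_)⟩
    exact (isUnit_subring_iff_inv_mem _).mpr ⟨ne_zero_of_valuation_eq_one hvd, hdinv⟩
  refine ⟨hTloc, ⟨(u₀ : K), hu₀T⟩, hu₀max, fun e => hu₀0' (congrArg Subtype.val e), hT₁loc, ?_, ?_,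
    subringDominates_of_locChar_of_comap hle hcomap hT hT₁⟩
  · -- `R_P[𝔪/u₀] ⊆ (R₁)_{P₁}`
    refine Subring.closure_le.mpr ?_
    rintro z (hz | ⟨y, hy, rfl⟩)
    · exact hTT₁ hz
    · obtain ⟨a, b, ha, hb, hy'⟩ := (mem_maximalIdeal_iff_of_locChar hT y).mp hy
      have hb0 : (b : K) ≠ 0 := coe_ne_zero_of_not_mem hb
      show ((y : T) : K) / u₀ ∈ T₁
      rw [hy', div_div, mul_comm, ← div_div]
      refine (hT₁ _).mpr ⟨⟨(a : K) / u₀, hCR₁ (hdivC a ha)⟩, ⟨b, hle b.2⟩,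
        fun h => hb ((inclusion_mem_iff_of_comap hle hcomap b).mp h), rfl⟩
  · -- every element of `(R₁)_{P₁}` is a fraction of elements of `C` with denominator a unit of `(R₁)_{P₁}`
    intro z hz
    obtain ⟨a₁, b₁, hb₁, rfl⟩ := (hT₁ z).mp hz
    have ha₁ : (a₁ : K) ∈ locAtCentre C O := hR₁ ▸ a₁.2
    have hb₁' : (b₁ : K) ∈ locAtCentre C O := hR₁ ▸ b₁.2
    obtain ⟨c, hc, d, hd, hvd, hac⟩ := mem_locAtCentre_iff.mp ha₁
    obtain ⟨c', hc', d', hd', hvd', hbc⟩ := mem_locAtCentre_iff.mp hb₁'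
    have hd0 := ne_zero_of_valuation_eq_one hvd
    have hd'0 := ne_zero_of_valuation_eq_one hvd'
    have hb₁0 : (b₁ : K) ≠ 0 := coe_ne_zero_of_not_mem hb₁
    have hc'0 : c' ≠ 0 := by
      intro e
      apply hb₁0
      rw [hbc, e, zero_div]
    obtain ⟨hdR₁, hdP₁⟩ := hunit d hd hvd
    obtain ⟨hd'R₁, hd'P₁⟩ := hunit d' hd' hvd'
    have hc'R₁ : c' ∈ R₁ := hCR₁ hc'
    have hc'P₁ : (⟨c', hc'R₁⟩ : R₁) ∉ P₁ := by
      intro hmem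
      have : b₁ * ⟨d', hd'R₁⟩ = ⟨c', hc'R₁⟩ := by
        apply Subtype.ext
        show (b₁ : K) * d' = c'
        rw [hbc, div_mul_cancel₀ _ hd'0]
      have hmem' : b₁ * ⟨d', hd'R₁⟩ ∈ P₁ := by rw [this]; exact hmem
      rcases hP₁.mem_or_mem hmem' with h | h
      · exact hb₁ h
      · exact hd'P₁ h
    refine ⟨c * d', hCbl (C.mul_mem hc hd'), d * c', hCbl (C.mul_mem hd hc'), ?_, ?_⟩
    · refine (hT₁ _).mpr ⟨1, ⟨d, hdR₁⟩ * ⟨c', hc'R₁⟩, fun h => (hP₁.mem_or_mem h).elim hdP₁ hc'P₁, ?_⟩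
      rw [Subring.coe_one, one_div]
      rfl
    · rw [hac, hbc]
      field_simp

omit hP₁ hbl in
/-- **The exceptional parameter generates `𝔪_{R_P}·(R₁)_{P₁}`**: for `x ∈ P` with `P ⊆ x·R₁` (the exceptional
generator `u₀`, or the strict-transform step's parameter of the same value), the extension of the maximal ideal of
`R_P` to `(R₁)_{P₁}` is the principal ideal `(x)`. [cite: Cutkosky2014, §2.1] [folklore] -/
theorem span_image_maximalIdeal_eq_of_locChar [IsLocalRing T] (hTT₁ : T ≤ T₁) (x : R) (hxP : x ∈ P)
    (hdiv : ∀ a : R, a ∈ P → ∃ r ∈ R₁, (a : K) = r * x) (hxT₁ : (x : K) ∈ T₁) :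
    Ideal.span ((fun y : T => (⟨(y : K), hTT₁ y.2⟩ : T₁)) '' (maximalIdeal T : Set T)) =
      Ideal.span {(⟨(x : K), hxT₁⟩ : T₁)} := by
  apply le_antisymm
  · refine Ideal.span_le.mpr ?_
    rintro _ ⟨y, hy, rfl⟩
    obtain ⟨a, b, ha, hb, hy'⟩ := (mem_maximalIdeal_iff_of_locChar hT y).mp hy
    obtain ⟨r, hr, har⟩ := hdiv a ha
    have hb0 : (b : K) ≠ 0 := coe_ne_zero_of_not_mem hb
    have hrb : r / (b : K) ∈ T₁ :=
      (hT₁ _).mpr ⟨⟨r, hr⟩, ⟨b, hle b.2⟩, fun h => hb ((inclusion_mem_iff_of_comap hle hcomap b).mp h), rfl⟩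
    refine Ideal.mem_span_singleton'.mpr ⟨⟨r / (b : K), hrb⟩, Subtype.ext ?_⟩
    show r / (b : K) * x = (y : K)
    rw [hy', har]
    field_simp
  · have hxT : (x : K) ∈ T := le_of_locChar hT x.2
    have hxmax : (⟨(x : K), hxT⟩ : T) ∈ maximalIdeal T :=
      (mem_maximalIdeal_iff_of_locChar hT _).mpr ⟨x, 1, hxP,
        fun h => hP.ne_top (P.eq_top_of_isUnit_mem h isUnit_one), by simp⟩
    refine Ideal.span_le.mpr (Set.singleton_subset_iff.mpr (Ideal.subset_span ⟨⟨(x : K), hxT⟩, hxmax, rfl⟩))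

end Quadratic

end GeoDict

end Summit.ResolutionOfSingularities.ResolutionOfSingularities.Theorems.SwitchingDichotomy

end
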